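import Literature.NumberTheory.DiophantineGeometry.CatalanCasselsTheorem
import HarnessLib

/-!
# Cassels' theorem on Catalan's equation: the Archimedean bounds of [Schoof2009, Corollary 6.5 (iii)]

`CatalanCasselsTheorem` proves Cassels' theorem (`Catalan.cassels`) and [Schoof2009,
Corollary 6.5] (i), (ii), and (iii) in the directly proved form `|x| ≥ p^(q-1) - 1`,
`|y| ≥ q^(p-1) - 1` (`Catalan.cassels_archimedean`), leaving out the comparison of
[Schoof2009, Exercise 6.3] that turns this into the printed
`|x| ≥ max(p^(q-1) - 1, q^(p-1) + q)`, `|y| ≥ max(q^(p-1) - 1, p^(q-1) + p)`. The later chapters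
use exactly the second entries ("By Corollary 6.5 (iii), we have `|x| ≥ q^(p-1) + q`",
[Schoof2009, Ch. 11, p. 76; Ch. 12, p. 86]), for *both* orderings of `p, q`. This file supplies
them:

* `Literature.NumberTheory.DiophantineGeometry.Catalan.pow_add_lt_pow_sub_one` — [Schoof2009,
  Exercise 6.3]: `q^(p-1) - 1 > p^(q-1) + p` for `p ≥ q + 2`, `q ≥ 3` (via
  `(1 + 1/n)^k ≤ e < 3` and an induction on `p`);
* `Literature.NumberTheory.DiophantineGeometry.Catalan.cassels_abs_x_ge`,
  `Literature.NumberTheory.DiophantineGeometry.Catalan.cassels_abs_y_ge` — for odd primes `p, q`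
  and non-zero integers with `x ^ p - y ^ q = 1`: `|x| ≥ q^(p-1) + q` and `|y| ≥ p^(q-1) + p`.

Everything is proved; no definitions, no named facts.
-/

namespace Literature.NumberTheory.DiophantineGeometry

namespace Catalan

open Finset

/-- `(n + 1)^k ≤ 3 n^k` for `1 ≤ n`, `k ≤ n` (since `(1 + 1/n)^k ≤ e^(k/n) ≤ e < 3`); the induction
step of [Schoof2009, Exercise 6.3]. [folklore] -/
theorem succ_pow_le_three_mul_pow {n k : ℕ} (hn : 1 ≤ n) (hk : k ≤ n) :
    ((n : ℝ) + 1) ^ k ≤ 3 * (n : ℝ) ^ k := by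
  have hn0 : (0 : ℝ) < n := by exact_mod_cast hn
  have h1 : ((n : ℝ) + 1) = n * (1 + 1 / n) := by field_simp
  rw [h1, mul_pow, mul_comm]
  apply mul_le_mul_of_nonneg_right _ (by positivity)
  have h2 : (1 : ℝ) + 1 / n ≤ Real.exp (1 / n) := by
    have := Real.add_one_le_exp (1 / (n : ℝ))
    linarith
  calc ((1 : ℝ) + 1 / n) ^ k ≤ Real.exp (1 / n) ^ k := pow_le_pow_left₀ (by positivity) h2 k
    _ = Real.exp (k / n) := by rw [← Real.exp_nat_mul]; congr 1; ring
    _ ≤ Real.exp 1 := by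
        apply Real.exp_le_exp.mpr
        rw [div_le_one hn0]
        exact_mod_cast hk
    _ ≤ 3 := by
        have := Real.exp_one_lt_d9
        linarith

/-- The base case `p = q + 2` of [Schoof2009, Exercise 6.3]: `(q + 2)^(q-1) + q + 4 ≤ q^(q+1)` for
`q ≥ 3` (as `(1 + 2/q)^(q-1) ≤ e² < 7.4` and `q² ≥ 9`). [cite: Schoof2009, Exercise 6.3] -/
theorem add_two_pow_add_le_pow {q : ℕ} (hq : 3 ≤ q) :
    ((q : ℝ) + 2) ^ (q - 1) + q + 4 ≤ (q : ℝ) ^ (q + 1) := by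
  have hq0 : (0 : ℝ) < q := by exact_mod_cast (show 0 < q by omega)
  have hq3 : (3 : ℝ) ≤ q := by exact_mod_cast hq
  -- (q+2)^(q-1) ≤ e^2 q^(q-1)
  have h1 : ((q : ℝ) + 2) ^ (q - 1) ≤ Real.exp 2 * (q : ℝ) ^ (q - 1) := by
    have e1 : ((q : ℝ) + 2) = q * (1 + 2 / q) := by field_simp
    rw [e1, mul_pow, mul_comm]
    apply mul_le_mul_of_nonneg_right _ (by positivity)
    have h2 : (1 : ℝ) + 2 / q ≤ Real.exp (2 / q) := by
      have := Real.add_one_le_exp (2 / (q : ℝ))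
      linarith
    calc ((1 : ℝ) + 2 / q) ^ (q - 1) ≤ Real.exp (2 / q) ^ (q - 1) :=
          pow_le_pow_left₀ (by positivity) h2 _
      _ = Real.exp (((q - 1 : ℕ) : ℝ) * (2 / q)) := by rw [← Real.exp_nat_mul]
      _ ≤ Real.exp 2 := by
          apply Real.exp_le_exp.mpr
          rw [Nat.cast_sub (by omega), Nat.cast_one]
          have e2 : ((q : ℝ) - 1) * (2 / q) = 2 - 2 / q := by field_simp
          rw [e2]
          have : (0 : ℝ) ≤ 2 / q := by positivity
          linarith
  have he2 : Real.exp 2 ≤ 74 / 10 := by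
    have h := Real.exp_one_lt_d9
    have : Real.exp 2 = Real.exp 1 * Real.exp 1 := by rw [← Real.exp_add]; norm_num
    rw [this]
    nlinarith [Real.exp_pos 1]
  -- q^(q+1) = q^2 q^(q-1) ≥ 9 q^(q-1), and q^(q-1) ≥ q^2
  have hpow : (q : ℝ) ^ (q + 1) = q ^ 2 * (q : ℝ) ^ (q - 1) := by
    rw [← pow_add]; congr 1; omega
  have hq2 : (q : ℝ) ^ 2 ≤ (q : ℝ) ^ (q - 1) := pow_le_pow_right₀ (by linarith) (by omega)
  have hqq : (0 : ℝ) ≤ (q : ℝ) ^ (q - 1) := by positivity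
  have hq9 : (9 : ℝ) ≤ (q : ℝ) ^ 2 := by nlinarith
  have hA : 9 * (q : ℝ) ^ (q - 1) ≤ (q : ℝ) ^ 2 * (q : ℝ) ^ (q - 1) :=
    mul_le_mul_of_nonneg_right hq9 hqq
  have hB : ((q : ℝ) + 2) ^ (q - 1) ≤ 74 / 10 * (q : ℝ) ^ (q - 1) :=
    h1.trans (mul_le_mul_of_nonneg_right he2 hqq)
  have hC : (q : ℝ) + 4 ≤ 16 / 10 * (q : ℝ) ^ 2 := by nlinarith
  rw [hpow]
  linarith

/-- **[Schoof2009, Exercise 6.3]**, real form, for all integers `p ≥ q + 2`, `q ≥ 3`: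
`p^(q-1) + p + 2 ≤ q^(p-1)`, by induction on `p` (`q^p ≥ 3 q^(p-1)` against
`(p+1)^(q-1) ≤ 3 p^(q-1)`). [cite: Schoof2009, Exercise 6.3] -/
theorem pow_add_add_two_le_pow {q : ℕ} (hq : 3 ≤ q) : ∀ p, q + 2 ≤ p →
    (p : ℝ) ^ (q - 1) + p + 2 ≤ (q : ℝ) ^ (p - 1) := by
  intro p hp
  induction p with
  | zero => omega
  | succ n ih =>
    rcases Nat.lt_or_ge n (q + 2) with h | h
    · -- n + 1 = q + 2
      have hn : n = q + 1 := by omega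
      subst hn
      have := add_two_pow_add_le_pow hq
      push_cast
      ring_nf at this ⊢
      linarith
    · have ih' := ih h
      have hq3 : (3 : ℝ) ≤ q := by exact_mod_cast hq
      have h3 := succ_pow_le_three_mul_pow (n := n) (k := q - 1) (by omega) (by omega)
      push_cast
      have hqn : (q : ℝ) ^ n = (q : ℝ) ^ (n - 1) * q := by rw [← pow_succ]; congr 1; omega
      have hQ : 3 * (q : ℝ) ^ (n - 1) ≤ (q : ℝ) ^ (n - 1) * q := by
        rw [mul_comm]
        exact mul_le_mul_of_nonneg_left hq3 (by positivity)
      have hn0 : (0 : ℝ) ≤ (n : ℝ) := by positivity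
      rw [hqn]
      linarith

/-- **[Schoof2009, Exercise 6.3]**: for odd primes `p > q` — more generally for integers `q ≥ 3`,
`p ≥ q + 2` — one has `q^(p-1) - 1 > p^(q-1) + p`. [cite: Schoof2009, Exercise 6.3] -/
theorem pow_add_lt_pow_sub_one {p q : ℕ} (hq : 3 ≤ q) (hp : q + 2 ≤ p) :
    (p : ℤ) ^ (q - 1) + p < (q : ℤ) ^ (p - 1) - 1 := by
  have h := pow_add_add_two_le_pow hq p hp
  have h' : ((p ^ (q - 1) + p + 2 : ℤ) : ℝ) ≤ ((q ^ (p - 1) : ℤ) : ℝ) := by push_cast; exact h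
  have := Int.cast_le.mp h'
  linarith

/-- **[Schoof2009, Corollary 6.5 (iii)] for `x`, as printed and as used later in the book**
("By Corollary 6.5 (iii), we have `|x| ≥ q^(p-1) + q`", Ch. 11, p. 76; Ch. 12, p. 86): for odd
primes `p, q` and non-zero integers with `x ^ p - y ^ q = 1`, `|x| ≥ q^(p-1) + q`. For `p > q`
this is Proposition 6.2 (ii) (`Catalan.abs_ge_of_pow_sub_pow_eq_one`); `p = q` is excluded by
Lemma 6.1; for `p < q`, `|x| ≥ p^(q-1) - 1` (`Catalan.cassels_archimedean`) and Exercise 6.3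
(`Catalan.pow_add_lt_pow_sub_one`) give `p^(q-1) - 1 > q^(p-1) + q`. Hence
`|x| ≥ max(p^(q-1) - 1, q^(p-1) + q)`. [cite: Schoof2009, Corollary 6.5 (iii)] -/
theorem cassels_abs_x_ge {p q : ℕ} (hp : p.Prime) (hq : q.Prime) (hpo : Odd p) (hqo : Odd q)
    {x y : ℤ} (hx : x ≠ 0) (hy : y ≠ 0) (h : x ^ p - y ^ q = 1) :
    (q : ℤ) ^ (p - 1) + q ≤ |x| := by
  have hq3 : 3 ≤ q := by obtain ⟨k, hk⟩ := hqo; have := hq.two_le; omega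
  have hp3 : 3 ≤ p := by obtain ⟨k, hk⟩ := hpo; have := hp.two_le; omega
  rcases lt_trichotomy q p with hqp | rfl | hpq
  · have := abs_ge_of_pow_sub_pow_eq_one hp hq hpo hqo hqp hx hy h
    linarith
  · exact absurd h (pow_sub_pow_ne_one hqo hq3 hx hy)
  · have h1 := (cassels_archimedean hp hq hpo hqo hx hy h).1
    have hpq2 : p + 2 ≤ q := by
      obtain ⟨k, hk⟩ := hpo
      obtain ⟨l, hl⟩ := hqo
      omega
    have h2 := pow_add_lt_pow_sub_one hp3 hpq2
    linarith

/-- **[Schoof2009, Corollary 6.5 (iii)] for `y`**: `|y| ≥ p^(q-1) + p` (apply `cassels_abs_x_ge` to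
`(-y)^q - (-x)^p = 1`); with `Catalan.cassels_archimedean`, `|y| ≥ max(q^(p-1) - 1, p^(q-1) + p)`.
[cite: Schoof2009, Corollary 6.5 (iii)] -/
theorem cassels_abs_y_ge {p q : ℕ} (hp : p.Prime) (hq : q.Prime) (hpo : Odd p) (hqo : Odd q)
    {x y : ℤ} (hx : x ≠ 0) (hy : y ≠ 0) (h : x ^ p - y ^ q = 1) :
    (p : ℤ) ^ (q - 1) + p ≤ |y| := by
  have h' : (-y) ^ q - (-x) ^ p = 1 := by rw [hqo.neg_pow, hpo.neg_pow]; linarith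
  have := cassels_abs_x_ge hq hp hqo hpo (neg_ne_zero.mpr hy) (neg_ne_zero.mpr hx) h'
  rwa [abs_neg] at this

end Catalan

end Literature.NumberTheory.DiophantineGeometry
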